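import Literature.MathematicalPhysics.QuantumFieldTheory.StrongCouplingTorusSystem
import Literature.MathematicalPhysics.QuantumFieldTheory.TorusFreeTransfer
import Literature.MathematicalPhysics.QuantumLattice.WilsonLoopsProofs
import HarnessLib

/-!
# The strong-coupling area law on the discrete torus and for infinite-volume limit states

Support file for the discharge of `Literature.MathematicalPhysics.QuantumFieldTheory.osterwalder_seiler_areaLaw`
(`LatticeGauge`, constructive-qft.S14: Osterwalder–Seiler, Ann. Phys. 110 (1978) 440, Thm. 5.1
with Thm. 3.1 and Lemma 5.2): the **volume-uniform area law for the torus Wilson states**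
`μ_{Λ_L, β}` of `ConstructiveQFTWave0` at strong coupling, for gauge group `G = SU(N)`, `N ≥ 2`
(`IsSpecialUnitaryModel ρ`), and its passage to every infinite-volume limit point
`μ ∈ infiniteVolumeLimitPoints ρ β` (`HasAreaLawWith μ (normalisedCharacter N ∘ ρ) K (-log (β/β₁))`,
`β₁ = betaOne d ρ` the strong-coupling radius of `StrongCouplingInfiniteVolume`).

The proof is the torus version of the argument of `Sweep1AreaLawProofs` (free boundary
conditions), run inside the abstract polymer expansion of `StrongCouplingPolymerSystem` for the
torus plaquette system `torusSystem ρ L` of `StrongCouplingTorusSystem`: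

* the torus Wilson loop expectation is the real part of `(torusSystem ρ L).expect W V β`
  (`wilsonExpectation_toTorusObservable_eq_re_expect`), and `expect_eq_sum` writes it as
  `∑_{Q seed-connected} aPol W Q β · ratio`, with `‖ratio‖ ≤ 2^{|N[Q]|}` (`norm_ratio_le`) and
  `‖aPol W Q β‖ ≤ (2Mβ)^{|Q|}` (`norm_aPol_le`) for `0 ≤ β ≤ β₁`;
* **`N`-ality** (OS78 §5): `aPol W Q β = 0` unless `|Q| ≥ R T`. For each unit square `(a, b)` of
  the `R × T` loop (at the origin of the fundamental domain, `(i, j)` plane) the *slab* centre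
  twist — multiplication by a central `z` with `ρ(z) = ζ·1`, `ζ ≠ 1`, of the `j`-bonds `(y, j)`
  with `a + 1 ≤ yᵢ ≤ a + R`, `yⱼ = b` — preserves `ν = zdHaar`, multiplies the loop holonomy by
  `z` (`twist_rectangle_slab`) and fixes the holonomy of every genuine torus plaquette outside the
  two flats `{yᵢ = a, yⱼ = b}`, `{yᵢ = a + R, yⱼ = b}` (`plaquetteHolonomy_torusSigma_twist_slab`;
  a slab is used instead of the half-space of `Sweep1AreaLawProofs` because a half-space of the
  fundamental domain has a second boundary at the wrap-around). A set of torus plaquettes meeting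
  all `R T` of these pairwise disjoint unions has `≥ R T` elements
  (`mul_le_card_of_forall_meets_tflat`);
* the counting of `norm_numZ_div_partZ_le` (`Polymer.sum_isSeedConn_pow_card_le` with
  `sum_isConn_eps_le` at `β₁`) then gives `|⟨W_{R×T}⟩_{Λ_L,β}| ≤ (2e^{1/2})^{K} (β/β₁)^{RT}`,
  `K ≤ 2(R+T)·2^d d²`, for all `L ≥ 2R + T + 3` (`abs_wilsonExpectation_wilsonLoop_le`), and
  `abs_rectExpectation_le_of_eventually` (`WilsonLoopsProofs`) passes the bound to limit points.

References: K. Osterwalder, E. Seiler, Ann. Phys. 110 (1978) 440, §3, §5 (Thm. 5.1, Lemma 5.2)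
[OsterwalderSeilerAnnPhys1978]; E. Seiler, LNP 159 (1982), Ch. 3 [SeilerLNP1982];
K. Wilson, Phys. Rev. D 10 (1974) 2445 [Wilson1974]. All statements here are proved. [folklore]
-/

noncomputable section

open MeasureTheory Filter Topology Finset
open Literature.MathematicalPhysics.QuantumLattice

namespace Literature.MathematicalPhysics.QuantumFieldTheory

open AreaLaw

namespace TorusAreaLaw

variable {d N : ℕ} {G : Type*}

/-! ### The slab centre twist on `ℤ^d` -/

section Slab

/-- The twisted bonds for the unit square `(a, b)` of a loop based at `x` in the `(i, j)` plane,
slab version: the `j`-bonds `(y, j)` with `xᵢ + a + 1 ≤ yᵢ ≤ xᵢ + a + w` and `yⱼ = xⱼ + b`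
(a vortex sheet with two boundary components; cf. `AreaLaw.twistSet`). [folklore] -/
def slabSet (x : Literature.Probability.LatticeModels.Site d) (i j : Fin d) (a w b : ℤ) :
    Set (ZdEdge d) :=
  {e | e.2 = j ∧ x i + a + 1 ≤ e.1 i ∧ e.1 i ≤ x i + a + w ∧ e.1 j = x j + b}

/-- Membership in the slab of twisted bonds, unfolded. [folklore] -/
theorem mem_slabSet_iff {x : Literature.Probability.LatticeModels.Site d} {i j : Fin d} {a w b : ℤ}
    {e : ZdEdge d} :
    e ∈ slabSet x i j a w b ↔ e.2 = j ∧ x i + a + 1 ≤ e.1 i ∧ e.1 i ≤ x i + a + w ∧ e.1 j = x j + b :=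
  Iff.rfl

/-- Membership in the slab is decidable. [folklore] -/
instance slabSet.decidablePred (x : Literature.Probability.LatticeModels.Site d) (i j : Fin d)
    (a w b : ℤ) : DecidablePred (· ∈ slabSet x i j a w b) := fun _ =>
  decidable_of_iff _ mem_slabSet_iff.symm

variable [Group G] {z : G}

/-- **Effect of the slab twist on the Wilson loop**: for `a < R ≤ w` and `b < T` the rectangular
holonomy is multiplied by the central element `z` (exactly one bond of the loop, on its far
`j`-side, is twisted). [folklore] -/
theorem twist_rectangle_slab (hz : ∀ g : G, g * z = z * g)
    (x : Literature.Probability.LatticeModels.Site d) {i j : Fin d} (hij : i ≠ j) {a b R T : ℕ}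
    {w : ℤ} (ha : a < R) (hw : (R : ℤ) ≤ w) (hb : b < T) (U : ZdGaugeConfig d G) :
    (twist (slabSet x i j a w b) z U).rectangle x i j R T = z * U.rectangle x i j R T := by
  unfold ZdGaugeConfig.rectangle
  have e1 : (twist (slabSet x i j a w b) z U).line i R x = U.line i R x := by
    refine twist_line_of_forall_not_mem i R x (fun t _ hmem => ?_) U
    exact hij (mem_slabSet_iff.mp hmem).1
  have e2 : (twist (slabSet x i j a w b) z U).line j T (x + Pi.single i (R : ℤ)) =
      z * U.line j T (x + Pi.single i (R : ℤ)) := by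
    refine twist_line_eq_mul hz j T _ b hb (fun t _ => ?_) U
    rw [mem_slabSet_iff]
    simp only [Pi.add_apply, Pi.single_eq_same, Pi.single_eq_of_ne hij,
      Pi.single_eq_of_ne (Ne.symm hij), true_and]
    omega
  have e3 : (twist (slabSet x i j a w b) z U).line i R (x + Pi.single j (T : ℤ)) =
      U.line i R (x + Pi.single j (T : ℤ)) := by
    refine twist_line_of_forall_not_mem i R _ (fun t _ hmem => ?_) U
    exact hij (mem_slabSet_iff.mp hmem).1
  have e4 : (twist (slabSet x i j a w b) z U).line j T x = U.line j T x := by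
    refine twist_line_of_forall_not_mem j T x (fun t _ hmem => ?_) U
    have := (mem_slabSet_iff.mp hmem).2.1
    simp only [Pi.add_apply, Pi.single_eq_of_ne hij] at this
    omega
  rw [e1, e2, e3, e4, ← mul_assoc (ZdGaugeConfig.line U i R x) z, hz]
  simp only [mul_assoc]

end Slab

/-! ### Torus plaquettes under a twist of the sectioned bonds -/

section Torus

variable {L : ℕ}

/-- The integer coordinates (in `{0, …, L-1}`) of the base point of a torus plaquette label
(`torusSiteLift`). [folklore] -/
def tcoord (p : TPlaq d L) (k : Fin d) : ℤ := ((p.1 k).val : ℤ)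

/-- `tcoord` is the canonical lift of the base point. [folklore] -/
theorem tcoord_eq (p : TPlaq d L) (k : Fin d) : tcoord p k = torusSiteLift p.1 k := rfl

variable [Group G]

/-- **A plaquette of the torus under a twist of bonds of `ℤ^d`** (read through the section
`torusSigma`): if the two `k`-bonds and the two `l`-bonds of the label `(x, k, l)` are twisted
alike, the plaquette holonomy is unchanged (the twisting element is central). [folklore] -/
theorem plaquetteHolonomy_torusSigma_twist (H : Set (ZdEdge d)) [DecidablePred (· ∈ H)] {z : G}
    (hz : ∀ g : G, g * z = z * g) (x : Site d L) (k l : Fin d)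
    (h1 : (torusSect L (x, k) ∈ H ↔ torusSect L (x.shift l, k) ∈ H))
    (h2 : (torusSect L (x.shift k, l) ∈ H ↔ torusSect L (x, l) ∈ H)) (U : ZdGaugeConfig d G) :
    plaquetteHolonomy (torusSigma L (twist H z U)) x k l =
      plaquetteHolonomy (torusSigma L U) x k l := by
  unfold plaquetteHolonomy twist
  simp only [torusSigma_apply]
  by_cases hA : torusSect L (x, k) ∈ H <;> by_cases hB : torusSect L (x.shift k, l) ∈ H
  · rw [if_pos hA, if_pos hB, if_pos (h1.mp hA), if_pos (h2.mp hB)]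
    calc z * U (torusSect L (x, k)) * (z * U (torusSect L (x.shift k, l))) *
          (z * U (torusSect L (x.shift l, k)))⁻¹ * (z * U (torusSect L (x, l)))⁻¹
        = z * (U (torusSect L (x, k)) * (z * (U (torusSect L (x.shift k, l)) *
            (U (torusSect L (x.shift l, k)))⁻¹) * z⁻¹) * (U (torusSect L (x, l)))⁻¹) * z⁻¹ := by
          group
      _ = _ := by rw [conj_eq_of_central hz, conj_eq_of_central hz]; group
  · rw [if_pos hA, if_neg hB, if_pos (h1.mp hA), if_neg (mt h2.mpr hB)]
    calc z * U (torusSect L (x, k)) * U (torusSect L (x.shift k, l)) *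
          (z * U (torusSect L (x.shift l, k)))⁻¹ * (U (torusSect L (x, l)))⁻¹
        = z * (U (torusSect L (x, k)) * U (torusSect L (x.shift k, l)) *
            (U (torusSect L (x.shift l, k)))⁻¹) * z⁻¹ * (U (torusSect L (x, l)))⁻¹ := by group
      _ = _ := by rw [conj_eq_of_central hz]
  · rw [if_neg hA, if_pos hB, if_neg (mt h1.mpr hA), if_pos (h2.mp hB)]
    calc U (torusSect L (x, k)) * (z * U (torusSect L (x.shift k, l))) *
          (U (torusSect L (x.shift l, k)))⁻¹ * (z * U (torusSect L (x, l)))⁻¹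
        = U (torusSect L (x, k)) * (z * (U (torusSect L (x.shift k, l)) *
            (U (torusSect L (x.shift l, k)))⁻¹ * (U (torusSect L (x, l)))⁻¹) * z⁻¹) := by group
      _ = _ := by rw [conj_eq_of_central hz]; group
  · rw [if_neg hA, if_neg hB, if_neg (mt h1.mpr hA), if_neg (mt h2.mpr hB)]

/-- Membership of a sectioned torus bond in the slab at the origin, in coordinates. [folklore] -/
theorem torusSect_mem_slabSet_iff {i j : Fin d} {a w b : ℤ} (y : Site d L) (m : Fin d) :
    torusSect L (y, m) ∈ slabSet (0 : Literature.Probability.LatticeModels.Site d) i j a w b ↔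
      m = j ∧ a + 1 ≤ torusSiteLift y i ∧ torusSiteLift y i ≤ a + w ∧ torusSiteLift y j = b := by
  simp only [torusSect, mem_slabSet_iff, Pi.zero_apply, zero_add]

/-- Coordinates of the lift of a shifted torus site: unchanged off the shift direction. [folklore] -/
theorem torusSiteLift_shift_of_ne (y : Site d L) {m k : Fin d} (h : k ≠ m) :
    torusSiteLift (y.shift m) k = torusSiteLift y k := by
  simp only [torusSiteLift, WilsonRP.shift_apply_of_ne _ h]

variable [NeZero L]

/-- Coordinate of the lift of a shifted torus site in the shift direction: `+1`, or wrap-around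
from `L - 1` to `0`. [folklore] -/
theorem torusSiteLift_shift_self [Fact (1 < L)] (y : Site d L) (m : Fin d) :
    (torusSiteLift (y.shift m) m = torusSiteLift y m + 1 ∧ torusSiteLift y m + 1 < L) ∨
      (torusSiteLift y m = L - 1 ∧ torusSiteLift (y.shift m) m = 0) := by
  simp only [torusSiteLift]
  have hv := WilsonRP.val_shift_self y m
  have hlt := ZMod.val_lt (y m)
  by_cases h : (y m).val + 1 = L
  · rw [if_pos h] at hv
    right
    constructor
    · omega
    · rw [hv]; simp
  · rw [if_neg h] at hv
    left
    rw [hv]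
    push_cast
    constructor
    · rfl
    · omega

/-- The coordinates of a lift lie in `{0, …, L-1}`. [folklore] -/
theorem torusSiteLift_nonneg_lt (y : Site d L) (k : Fin d) :
    0 ≤ torusSiteLift y k ∧ torusSiteLift y k < L := by
  simp only [torusSiteLift]
  exact ⟨by positivity, by exact_mod_cast ZMod.val_lt (y k)⟩

/-- **The slab twist off the two flats.** For the slab `a + 1 ≤ yᵢ ≤ a + R`, `yⱼ = b` with
`a + R + 2 ≤ L`, shifting a torus site in a direction `m ≠ j` does not change the slab
membership of its lift, unless the site lies on one of the two flats `yᵢ = a` or `yᵢ = a + R`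
(with `yⱼ = b`). [folklore] -/
theorem slabMem_shift_iff [Fact (1 < L)] {i j : Fin d} (hij : i ≠ j) {a R b : ℕ}
    (hL : a + R + 2 ≤ L) (y : Site d L) {m : Fin d} (hm : m ≠ j)
    (hpa : ¬ (torusSiteLift y i = a ∧ torusSiteLift y j = b))
    (hpb : ¬ (torusSiteLift y i = a + R ∧ torusSiteLift y j = b)) :
    ((a : ℤ) + 1 ≤ torusSiteLift (y.shift m) i ∧ torusSiteLift (y.shift m) i ≤ a + R ∧
        torusSiteLift (y.shift m) j = b) ↔
      ((a : ℤ) + 1 ≤ torusSiteLift y i ∧ torusSiteLift y i ≤ a + R ∧ torusSiteLift y j = b) := by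
  rw [torusSiteLift_shift_of_ne y hm.symm]
  by_cases hmi : m = i
  · subst hmi
    have hi := torusSiteLift_nonneg_lt y m
    rcases torusSiteLift_shift_self y m with ⟨h1, h2⟩ | ⟨h1, h2⟩
    · rw [h1]
      constructor
      · rintro ⟨h3, h4, h5⟩
        refine ⟨?_, by omega, h5⟩
        by_contra h6
        exact hpa ⟨by omega, h5⟩
      · rintro ⟨h3, h4, h5⟩
        refine ⟨by omega, ?_, h5⟩
        by_contra h6
        exact hpb ⟨by omega, h5⟩
    · rw [h1, h2]
      constructor
      · rintro ⟨h3, -, -⟩; omega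
      · rintro ⟨-, h4, -⟩; omega
  · rw [torusSiteLift_shift_of_ne y (Ne.symm hmi)]

/-- The flat of torus plaquette labels over the unit square `(c, b)` of the `(i, j)` plane:
labels whose base point has coordinates `yᵢ = c`, `yⱼ = b`. [folklore] -/
def tflat (i j : Fin d) (c b : ℤ) : Set (TPlaq d L) := {p | tcoord p i = c ∧ tcoord p j = b}

omit [NeZero L] in
/-- Membership in a flat, unfolded. [folklore] -/
theorem mem_tflat_iff {i j : Fin d} {c b : ℤ} {p : TPlaq d L} :
    p ∈ tflat i j c b ↔ tcoord p i = c ∧ tcoord p j = b := Iff.rfl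

/-- **Effect of the slab twist on torus plaquettes**: a genuine (`k ≠ l`) torus plaquette outside
the two flats of the twisted square has unchanged holonomy (Osterwalder–Seiler 1978 §5, torus
version). [folklore] -/
theorem plaquetteHolonomy_torusSigma_twist_slab [Fact (1 < L)] {z : G}
    (hz : ∀ g : G, g * z = z * g) {i j : Fin d} (hij : i ≠ j) {a R b : ℕ} (hL : a + R + 2 ≤ L)
    (p : TPlaq d L) (hkl : p.2.1 ≠ p.2.2) (hpa : p ∉ tflat i j a b)
    (hpb : p ∉ tflat i j (a + R) b) (U : ZdGaugeConfig d G) :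
    plaquetteHolonomy (torusSigma L
        (twist (slabSet (0 : Literature.Probability.LatticeModels.Site d) i j a R b) z U))
        p.1 p.2.1 p.2.2 = plaquetteHolonomy (torusSigma L U) p.1 p.2.1 p.2.2 := by
  rw [mem_tflat_iff, tcoord_eq, tcoord_eq] at hpa hpb
  refine plaquetteHolonomy_torusSigma_twist _ hz p.1 p.2.1 p.2.2 ?_ ?_ U
  · simp only [torusSect_mem_slabSet_iff]
    by_cases hk : p.2.1 = j
    · simp only [hk, true_and]
      exact (slabMem_shift_iff hij hL p.1 (m := p.2.2) (fun h => hkl (hk.trans h.symm)) hpa hpb).symm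
    · simp only [hk, false_and]
  · simp only [torusSect_mem_slabSet_iff]
    by_cases hl : p.2.2 = j
    · simp only [hl, true_and]
      exact slabMem_shift_iff hij hL p.1 (m := p.2.1) (fun h => hkl (h.trans hl.symm)) hpa hpb
    · simp only [hl, false_and]

omit [Group G] [NeZero L] in
/-- **Area constraint on the torus.** A finite set of torus plaquette labels meeting, for every
unit square `(a, b)` of the `R × T` loop, one of the two flats over `(a, b)` and `(a + R, b)`
has at least `R T` elements (these unions are pairwise disjoint). [folklore] -/
theorem mul_le_card_of_forall_meets_tflat (i j : Fin d) (R T : ℕ) (A : Finset (TPlaq d L))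
    (h : ∀ a : ℕ, a < R → ∀ b : ℕ, b < T →
      ∃ p ∈ A, p ∈ tflat i j a b ∨ p ∈ tflat i j (a + R) b) : R * T ≤ #A := by
  classical
  let ψ : TPlaq d L → ℤ × ℤ := fun p =>
    (if tcoord p i < R then tcoord p i else tcoord p i - R, tcoord p j)
  let S : Finset (ℤ × ℤ) := (range R ×ˢ range T).image fun ab => ((ab.1 : ℤ), (ab.2 : ℤ))
  have hS : #S = R * T := by
    rw [card_image_of_injective _ (fun ab ab' h => ?_), card_product, card_range, card_range]
    simp only [Prod.mk.injEq, Nat.cast_inj] at h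
    exact Prod.ext h.1 h.2
  have hsub : S ⊆ A.image ψ := by
    intro ab hab
    obtain ⟨⟨a', b'⟩, hab', rfl⟩ := mem_image.mp hab
    rw [mem_product, mem_range, mem_range] at hab'
    obtain ⟨p, hpA, hp⟩ := h a' hab'.1 b' hab'.2
    refine mem_image.mpr ⟨p, hpA, ?_⟩
    simp only [mem_tflat_iff] at hp
    rcases hp with ⟨h1, h2⟩ | ⟨h1, h2⟩
    · simp only [ψ, h1, h2, Prod.mk.injEq, and_true]
      rw [if_pos (by exact_mod_cast hab'.1)]
    · simp only [ψ, h1, h2, Prod.mk.injEq, and_true]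
      rw [if_neg (by omega)]
      ring
  calc R * T = #S := hS.symm
    _ ≤ #(A.image ψ) := card_le_card hsub
    _ ≤ #A := card_image_le

end Torus

/-! ### The loop in the fundamental domain -/

section Domain

variable {L : ℕ} [NeZero L]

/-- A bond based in the fundamental domain `{0, …, L-1}^d` is its own reduction. [folklore] -/
theorem torusRed_eq_self {e : ZdEdge d} (h : ∀ k, 0 ≤ e.1 k ∧ e.1 k < L) : torusRed L e = e := by
  rcases e with ⟨y, m⟩
  simp only [torusRed, torusSect, QuantumLattice.torusEdge, Prod.mk.injEq, and_true]
  funext k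
  simp only [torusSiteLift, Literature.Probability.LatticeModels.Torus.proj_apply, ZMod.val_intCast]
  obtain ⟨h0, hL⟩ := h k
  rw [Int.emod_eq_of_lt h0 hL]

/-- The bonds of the `R × T` loop at the origin have coordinates in `{0, …, R + T}`. [folklore] -/
theorem coord_of_mem_loopEdges {i j : Fin d} {R T : ℕ} {e : ZdEdge d}
    (he : e ∈ loopEdges (0 : Literature.Probability.LatticeModels.Site d) i j R T) (k : Fin d) :
    0 ≤ e.1 k ∧ e.1 k ≤ R + T := by
  simp only [loopEdges, Finset.mem_union] at he
  have hs : ∀ (m : Fin d) (t : ℤ), 0 ≤ t → (0 : ℤ) ≤ (Pi.single m t : Fin d → ℤ) k ∧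
      (Pi.single m t : Fin d → ℤ) k ≤ t := by
    intro m t ht
    by_cases hk : k = m
    · subst hk; simp [ht]
    · simp [Pi.single_eq_of_ne hk, ht]
  rcases he with ((he | he) | he) | he
  · obtain ⟨t, ht, rfl⟩ := mem_lineEdges_iff.1 he
    have := hs i t (by positivity)
    simp only [zero_add]
    constructor <;> omega
  · obtain ⟨t, ht, rfl⟩ := mem_lineEdges_iff.1 he
    have h1 := hs i R (by positivity)
    have h2 := hs j t (by positivity)
    simp only [zero_add, Pi.add_apply]
    constructor <;> omega
  · obtain ⟨t, ht, rfl⟩ := mem_lineEdges_iff.1 he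
    have h1 := hs j T (by positivity)
    have h2 := hs i t (by positivity)
    simp only [zero_add, Pi.add_apply]
    constructor <;> omega
  · obtain ⟨t, ht, rfl⟩ := mem_lineEdges_iff.1 he
    have := hs j t (by positivity)
    simp only [zero_add]
    constructor <;> omega

/-- For `R + T < L` the bonds of the loop at the origin are their own reductions. [folklore] -/
theorem torusRed_eq_self_of_mem_loopEdges {i j : Fin d} {R T : ℕ} (hRT : R + T < L) {e : ZdEdge d}
    (he : e ∈ loopEdges (0 : Literature.Probability.LatticeModels.Site d) i j R T) :
    torusRed L e = e :=
  torusRed_eq_self fun k => ⟨(coord_of_mem_loopEdges he k).1, by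
    have := (coord_of_mem_loopEdges he k).2; omega⟩

/-- The image of the loop bonds under the reduction is the set of loop bonds. [folklore] -/
theorem image_torusRed_loopEdges {i j : Fin d} {R T : ℕ} (hRT : R + T < L) :
    (loopEdges (0 : Literature.Probability.LatticeModels.Site d) i j R T).image (torusRed L) =
      loopEdges (0 : Literature.Probability.LatticeModels.Site d) i j R T := by
  rw [Finset.image_congr (g := id) fun e he => ?_, Finset.image_id]
  exact torusRed_eq_self_of_mem_loopEdges hRT (Finset.mem_coe.1 he)

variable [Group G] (ρ : G →* Matrix (Fin N) (Fin N) ℂ)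

/-- **The twisted loop observable is the loop observable**: for `R + T < L` the Wilson loop at
the origin does not see the reduction `U ↦ U ∘ torusRed L`. [folklore] -/
theorem zdWilsonLoop_comp_torusRed {i j : Fin d} {R T : ℕ} (hRT : R + T < L) (U : ZdGaugeConfig d G) :
    zdWilsonLoop ρ 0 i j R T (U ∘ torusRed L) = zdWilsonLoop ρ 0 i j R T U :=
  dependsOn_zdWilsonLoop (ρ := ρ) 0 i j R T fun e he => by
    show U (torusRed L e) = U e
    rw [torusRed_eq_self_of_mem_loopEdges hRT (Finset.mem_coe.1 he)]

end Domain

/-! ### Vanishing of the sub-area terms -/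

section Vanishing

variable [Group G] [TopologicalSpace G] [IsTopologicalGroup G] [CompactSpace G] [MeasurableSpace G]
  [BorelSpace G] (ρ : G →* Matrix (Fin N) (Fin N) ℂ)

/-- **`N`-ality selection rule, abstract twist** (Osterwalder–Seiler 1978 §5). For `G = SU(N)`,
`N ≥ 2`: if a set `H` of bonds is such that every centre twist along `H` multiplies the
rectangular holonomy by the twisting element, and `Φ` is a bounded measurable function invariant
under these twists, then `∫ W_{R×T} Φ dg_∞ = 0`. [folklore] -/
theorem integral_zdWilsonLoop_mul_eq_zero_of_twist [SecondCountableTopology G]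
    (hρ : IsSpecialUnitaryModel ρ) (hN : 2 ≤ N) (H : Set (ZdEdge d)) [DecidablePred (· ∈ H)]
    (x : Literature.Probability.LatticeModels.Site d) (i j : Fin d) (R T : ℕ)
    (hH : ∀ z : G, (∀ g, g * z = z * g) → ∀ U : ZdGaugeConfig d G,
      (twist H z U).rectangle x i j R T = z * U.rectangle x i j R T)
    (Φ : ZdGaugeConfig d G → ℝ) (hΦm : Measurable Φ) {C : ℝ} (hΦb : ∀ U, |Φ U| ≤ C)
    (hΦ : ∀ z : G, (∀ g, g * z = z * g) → ∀ U, Φ (twist H z U) = Φ U) :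
    ∫ U, zdWilsonLoop ρ x i j R T U * Φ U ∂zdHaar d G = 0 := by
  obtain ⟨z, ζ, hζ, hz1, hzc⟩ := IsSpecialUnitaryModel.exists_central ρ hρ hN
  have hu := IsSpecialUnitaryModel.mem_unitaryGroup ρ hρ
  -- `‖tr M‖ ≤ N` for unitary `M` (cf. `abs_re_trace_le_of_mem_unitaryGroup`)
  have htr : ∀ {M : Matrix (Fin N) (Fin N) ℂ}, M ∈ Matrix.unitaryGroup (Fin N) ℂ → ‖M.trace‖ ≤ N := by
    intro M hM
    calc ‖M.trace‖ = ‖∑ i, M i i‖ := rfl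
      _ ≤ ∑ i, ‖M i i‖ := norm_sum_le _ _
      _ ≤ ∑ _i : Fin N, (1 : ℝ) := Finset.sum_le_sum fun i _ => entry_norm_bound_of_unitary hM i i
      _ = N := by simp
  set Wc : ZdGaugeConfig d G → ℂ := fun U => (ρ (U.rectangle x i j R T)).trace with hWc_def
  have hWc_cont : Continuous Wc := (hρ.1.comp (continuous_rectangle x i j R T)).matrix_trace
  have hWcτ : ∀ U, Wc (twist H z U) = ζ * Wc U := by
    intro U
    simp only [hWc_def, hH z hzc U, map_mul, hz1, smul_mul_assoc, one_mul, Matrix.trace_smul,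
      smul_eq_mul]
  have hmeas : Measurable fun U => Wc U * (Φ U : ℂ) :=
    hWc_cont.measurable.mul (Complex.measurable_ofReal.comp hΦm)
  have hint : Integrable (fun U => Wc U * (Φ U : ℂ)) (zdHaar d G) := by
    refine Integrable.of_bound hmeas.aestronglyMeasurable (N * C) (Eventually.of_forall fun U => ?_)
    rw [norm_mul, Complex.norm_real, Real.norm_eq_abs]
    exact mul_le_mul (htr (hu _)) (hΦb U) (abs_nonneg _) (Nat.cast_nonneg _)
  set J : ℂ := ∫ U, Wc U * (Φ U : ℂ) ∂zdHaar d G with hJ_def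
  have hJ : J = ζ * J := by
    calc J = ∫ U, Wc (twist H z U) * (Φ (twist H z U) : ℂ) ∂zdHaar d G :=
          (integral_zdHaar_comp_twist _ z hint.aestronglyMeasurable).symm
      _ = ∫ U, ζ * (Wc U * (Φ U : ℂ)) ∂zdHaar d G := by
          refine integral_congr_ae (ae_of_all _ fun U => ?_)
          simp only [hWcτ, hΦ z hzc]; ring
      _ = ζ * J := integral_const_mul _ _
  have hJ0 : J = 0 := by
    have h1 : (1 - ζ) * J = 0 := by rw [sub_mul, one_mul, ← hJ, sub_self]
    rcases mul_eq_zero.mp h1 with h | h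
    · exact absurd (sub_eq_zero.mp h).symm hζ
    · exact h
  have hre : ∀ U, zdWilsonLoop ρ x i j R T U * Φ U = (N : ℝ)⁻¹ * (Wc U * (Φ U : ℂ)).re := by
    intro U
    simp only [zdWilsonLoop, hWc_def, Complex.mul_re, Complex.ofReal_re, Complex.ofReal_im,
      mul_zero, sub_zero]
    ring
  simp_rw [hre]
  rw [integral_const_mul]
  have := integral_re hint
  simp only [RCLike.re_to_complex] at this
  rw [this, ← hJ_def, hJ0, Complex.zero_re, mul_zero]

variable {L : ℕ} [NeZero L]

omit [TopologicalSpace G] [IsTopologicalGroup G] [CompactSpace G] [MeasurableSpace G]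
  [BorelSpace G] in
/-- For real `β` the weights of the torus system are real:
`∏_{p ∈ Q} f_p = ∏_{p ∈ Q} (e^{-β s_p} - 1)`. [folklore] -/
theorem weightProd_torusSystem_ofReal (β : ℝ) (Q : Finset (TPlaq d L)) (U : ZdGaugeConfig d G) :
    (torusSystem ρ L).weightProd (β : ℂ) Q U =
      ((∏ p ∈ Q, (Real.exp (-(β * torusCost ρ L p U)) - 1) : ℝ) : ℂ) := by
  rw [Complex.ofReal_prod]
  refine Finset.prod_congr rfl fun p _ => ?_
  simp only [PlaqSystem.weight, torusSystem_cost, Complex.ofReal_sub, Complex.ofReal_one,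
    Complex.ofReal_exp, Complex.ofReal_neg, Complex.ofReal_mul]

omit [IsTopologicalGroup G] [MeasurableSpace G] [BorelSpace G] [NeZero L] in
/-- A crude bound for the real weight products: `|∏ (e^{-β s_p} - 1)| ≤ (e^{|β| M} + 1)^{|Q|}`.
[folklore] -/
theorem abs_prod_weight_le (hρ : Continuous ρ) (β : ℝ) (Q : Finset (TPlaq d L))
    (U : ZdGaugeConfig d G) :
    |∏ p ∈ Q, (Real.exp (-(β * torusCost ρ L p U)) - 1)| ≤
      (Real.exp (|β| * costBound ρ) + 1) ^ #Q := by
  rw [Finset.abs_prod, ← Finset.prod_const]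
  refine Finset.prod_le_prod (fun _ _ => abs_nonneg _) fun p _ => ?_
  have hc := abs_torusCost_le ρ hρ L p U
  have h1 : -(β * torusCost ρ L p U) ≤ |β| * costBound ρ := by
    calc -(β * torusCost ρ L p U) ≤ |-(β * torusCost ρ L p U)| := le_abs_self _
      _ = |β| * |torusCost ρ L p U| := by rw [abs_neg, abs_mul]
      _ ≤ |β| * costBound ρ := by gcongr
  calc |Real.exp (-(β * torusCost ρ L p U)) - 1|
      ≤ |Real.exp (-(β * torusCost ρ L p U))| + |(1 : ℝ)| := abs_sub _ _
    _ = Real.exp (-(β * torusCost ρ L p U)) + 1 := by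
        rw [abs_of_pos (Real.exp_pos _), abs_one]
    _ ≤ Real.exp (|β| * costBound ρ) + 1 := by gcongr

omit [CompactSpace G] [NeZero L] in
/-- The real weight products are measurable. [folklore] -/
theorem measurable_prod_weight (hρ : Continuous ρ) (β : ℝ) (Q : Finset (TPlaq d L)) :
    Measurable fun U : ZdGaugeConfig d G => ∏ p ∈ Q, (Real.exp (-(β * torusCost ρ L p U)) - 1) :=
  Finset.measurable_prod _ fun p _ =>
    ((measurable_torusCost ρ hρ L p).const_mul β).neg.exp.sub measurable_const

/-- **Area law for the terms of the torus expansion** (Osterwalder–Seiler 1978 §5, torus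
version): for `G = SU(N)`, `N ≥ 2`, real `β`, a set `Q` of genuine torus plaquettes with
`|Q| < R T` and `2R + 1 ≤ L`, the decorated activity `aPol W_{R×T} Q β` of the torus system
vanishes. [folklore] -/
theorem aPol_zdWilsonLoop_eq_zero [Fact (1 < L)] (hρ : IsSpecialUnitaryModel ρ) (hN : 2 ≤ N)
    {i j : Fin d} (hij : i ≠ j) {R T : ℕ} (hRL : 2 * R + 1 ≤ L) (β : ℝ) {Q : Finset (TPlaq d L)}
    (hQ : ∀ p ∈ Q, p.2.1 ≠ p.2.2) (hcard : #Q < R * T) :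
    (torusSystem ρ L).aPol (fun U => ((zdWilsonLoop ρ 0 i j R T U : ℝ) : ℂ)) Q β = 0 := by
  classical
  haveI := IsSpecialUnitaryModel.secondCountableTopology ρ hρ
  -- some unit square has both of its flats missed by `Q`
  obtain ⟨a, ha, b, hb, hab⟩ : ∃ a, a < R ∧ ∃ b, b < T ∧
      ∀ p ∈ Q, p ∉ tflat i j a b ∧ p ∉ tflat i j (a + R) b := by
    by_contra hcon
    push Not at hcon
    have := mul_le_card_of_forall_meets_tflat i j R T Q fun a ha b hb => ?_
    · omega
    · obtain ⟨p, hp, h⟩ := hcon a ha b hb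
      by_cases h' : p ∈ tflat i j a b
      · exact ⟨p, hp, Or.inl h'⟩
      · exact ⟨p, hp, Or.inr (h h')⟩
  set φ : ZdGaugeConfig d G → ℝ := fun U => ∏ p ∈ Q, (Real.exp (-(β * torusCost ρ L p U)) - 1)
    with hφ_def
  have hφτ : ∀ z : G, (∀ g, g * z = z * g) → ∀ U,
      φ (twist (slabSet (0 : Literature.Probability.LatticeModels.Site d) i j a R b) z U) = φ U := by
    intro z hz U
    refine Finset.prod_congr rfl fun p hp => ?_
    simp only [torusCost]
    rw [plaquetteHolonomy_torusSigma_twist_slab hz hij (by omega) p (hQ p hp) (hab p hp).1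
      (hab p hp).2]
  have hrect : ∀ z : G, (∀ g, g * z = z * g) → ∀ U : ZdGaugeConfig d G,
      (twist (slabSet (0 : Literature.Probability.LatticeModels.Site d) i j a R b) z U).rectangle
        0 i j R T = z * U.rectangle 0 i j R T :=
    fun z hz U => twist_rectangle_slab hz 0 hij ha le_rfl hb U
  have hI := integral_zdWilsonLoop_mul_eq_zero_of_twist ρ hρ hN
    (slabSet (0 : Literature.Probability.LatticeModels.Site d) i j a R b) 0 i j R T hrect φ
    (measurable_prod_weight ρ hρ.1 β Q) (abs_prod_weight_le ρ hρ.1 β Q) hφτ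
  unfold PlaqSystem.aPol
  simp_rw [weightProd_torusSystem_ofReal]
  have hmul : ∀ U, ((zdWilsonLoop ρ 0 i j R T U : ℝ) : ℂ) *
      ((∏ p ∈ Q, (Real.exp (-(β * torusCost ρ L p U)) - 1) : ℝ) : ℂ) =
        ((zdWilsonLoop ρ 0 i j R T U * φ U : ℝ) : ℂ) := fun U => by
    simp only [hφ_def, Complex.ofReal_mul]
  simp_rw [hmul]
  rw [integral_complex_ofReal, hI, Complex.ofReal_zero]

end Vanishing

/-! ### The area-law bound for the torus system -/

section Bound

/-- The number of plaquette labels touching a bond set: `|seedsOf B| ≤ |B| · 2^d d²`. [folklore] -/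
theorem card_plaqSeedsOf_le (B : Finset (ZdEdge d)) : #(Plaq.seedsOf B) ≤ #B * (2 ^ d * (d * d)) := by
  unfold Plaq.seedsOf
  refine (Finset.card_filter_le _ _).trans (Finset.card_biUnion_le.trans ?_)
  refine (Finset.sum_le_sum fun e _ => ?_).trans (by rw [Finset.sum_const, smul_eq_mul])
  rw [Finset.card_product, Finset.card_product, Fintype.card_piFinset, Finset.card_univ,
    Fintype.card_fin]
  refine le_of_eq ?_
  congr 1
  rw [Finset.prod_congr rfl fun k _ => (show #(Finset.Icc (e.1 k - 1) (e.1 k)) = 2 from ?_),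
    Finset.prod_const, Finset.card_univ, Fintype.card_fin]
  rw [Int.card_Icc, show e.1 k + 1 - (e.1 k - 1) = 2 by ring]
  rfl

variable [Group G] [TopologicalSpace G] [IsTopologicalGroup G] [CompactSpace G] [MeasurableSpace G]
  [BorelSpace G] (ρ : G →* Matrix (Fin N) (Fin N) ℂ)

/-- **The strong-coupling area law for the torus plaquette system** (Osterwalder–Seiler 1978
Thm. 5.1 / Lemma 5.2, torus version, via the polymer representation `expect_eq_sum`): for
`G = SU(N)`, `N ≥ 2`, `0 ≤ β ≤ β₁ = betaOne d ρ`, `2R + 1 ≤ L` and `R + T < L`,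
`‖⟨W_{R×T}⟩^T_L(β)‖ ≤ (2 e^{1/2})^{2(R+T) 2^d d²} (β/β₁)^{R T}`. [folklore] -/
theorem norm_expect_zdWilsonLoop_le {L : ℕ} [NeZero L] [Fact (1 < L)]
    (hρ : IsSpecialUnitaryModel ρ) (hN : 2 ≤ N) {i j : Fin d} (hij : i ≠ j) {R T : ℕ}
    (hRL : 2 * R + 1 ≤ L) (hRT : R + T < L) {β : ℝ} (hβ0 : 0 ≤ β) (hβ : β ≤ betaOne d ρ) :
    ‖(torusSystem ρ L).expect (fun U => ((zdWilsonLoop ρ 0 i j R T U : ℝ) : ℂ))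
        (torusGenuine d L) β‖ ≤
      (2 * Real.exp (1 / 2)) ^ (2 * (R + T) * (2 ^ d * (d * d))) * (β / betaOne d ρ) ^ (R * T) := by
  classical
  haveI := IsSpecialUnitaryModel.secondCountableTopology ρ hρ
  have hu := IsSpecialUnitaryModel.mem_unitaryGroup ρ hρ
  set S := torusSystem (G := G) ρ L with hS
  have hR : S.Regular (costBound ρ) (Plaq.degBound d) := torusSystem_regular ρ hρ.1
  set M := costBound ρ with hM
  set D := Plaq.degBound d with hD
  set B : Finset (ZdEdge d) := loopEdges (0 : Literature.Probability.LatticeModels.Site d) i j R T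
    with hB
  set F : ZdGaugeConfig d G → ℂ := fun U => ((zdWilsonLoop ρ 0 i j R T U : ℝ) : ℂ) with hF
  have hFm : Measurable F :=
    Complex.measurable_ofReal.comp (continuous_zdWilsonLoop ρ hρ.1 0 i j R T).measurable
  have hFb : ∀ U, ‖F U‖ ≤ 1 := fun U => by
    rw [hF, Complex.norm_real, Real.norm_eq_abs]; exact abs_zdWilsonLoop_le ρ hu 0 i j R T U
  have hFB : DependsOn F (B : Set (ZdEdge d)) := fun U V h => by
    simp only [hF, dependsOn_zdWilsonLoop (ρ := ρ) 0 i j R T h]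
  have hb1 : 0 < betaOne d ρ := betaOne_pos d (ρ := ρ)
  have hβR : PlaqSystem.betaR M D = betaOne d ρ := betaR_costBound ρ
  have hβn : ‖(β : ℂ)‖ ≤ PlaqSystem.betaR M D := by
    rw [Complex.norm_real, Real.norm_eq_abs, abs_of_nonneg hβ0, hβR]; exact hβ
  have hb1n : ‖((betaOne d ρ : ℝ) : ℂ)‖ ≤ PlaqSystem.betaR M D := by
    rw [Complex.norm_real, Real.norm_eq_abs, abs_of_pos hb1, hβR]
  have hβM : ‖(β : ℂ)‖ * M ≤ 1 := PlaqSystem.norm_mul_le_one hR hβn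
  set ε : ℝ := 2 * M * ‖(β : ℂ)‖ with hε
  set ε₁ : ℝ := 2 * M * ‖((betaOne d ρ : ℝ) : ℂ)‖ with hε₁
  set r : ℝ := β / betaOne d ρ with hr
  have hr0 : 0 ≤ r := div_nonneg hβ0 hb1.le
  have hr1 : r ≤ 1 := (div_le_one hb1).2 hβ
  have hεr : ε = r * ε₁ := by
    simp only [hε, hε₁, hr, Complex.norm_real, Real.norm_eq_abs, abs_of_nonneg hβ0, abs_of_pos hb1]
    field_simp
  have hM0 : 0 < M := costBound_pos ρ
  have hε₁0 : 0 ≤ ε₁ := by rw [hε₁]; positivity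
  set K := #(S.seedsOf B) with hK
  set Tset := (torusGenuine d L).powerset.filter (Polymer.IsSeedConn S.Adj (S.Touches B)) with hTset
  have hV : ∀ Q₁ ∈ Tset, ∀ p ∈ Q₁, p.2.1 ≠ p.2.2 := fun Q₁ hQ₁ p hp =>
    (mem_torusGenuine.1 (mem_powerset.1 (mem_filter.1 hQ₁).1 hp)).ne
  have hone : (1 : ℝ) ≤ 2 * Real.exp (1 / 2) := by
    have := Real.one_le_exp (by norm_num : (0 : ℝ) ≤ 1 / 2); linarith
  have hKle : K ≤ 2 * (R + T) * (2 ^ d * (d * d)) := by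
    calc K ≤ #(Plaq.seedsOf B) := by
          have := card_seedsOf_torusSystem_le (G := G) ρ (L := L) B
          rwa [image_torusRed_loopEdges hRT] at this
      _ ≤ #B * (2 ^ d * (d * d)) := card_plaqSeedsOf_le B
      _ ≤ 2 * (R + T) * (2 ^ d * (d * d)) := Nat.mul_le_mul_right _ (card_loopEdges_le 0 i j R T)
  rw [PlaqSystem.expect_eq_sum hR hFm hFb hFB (torusGenuine d L) β]
  calc ‖∑ Q₁ ∈ Tset, S.aPol F Q₁ β * S.ratio (torusGenuine d L) (S.snbAll B Q₁) β‖
      ≤ ∑ Q₁ ∈ Tset, ‖S.aPol F Q₁ β * S.ratio (torusGenuine d L) (S.snbAll B Q₁) β‖ :=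
        norm_sum_le _ _
    _ ≤ ∑ Q₁ ∈ Tset, 2 ^ K * r ^ (R * T) * (ε₁ * 2 ^ D) ^ #Q₁ := by
        refine Finset.sum_le_sum fun Q₁ hQ₁ => ?_
        rw [norm_mul]
        have h2 : ‖S.ratio (torusGenuine d L) (S.snbAll B Q₁) β‖ ≤ 2 ^ (K + D * #Q₁) := by
          refine (PlaqSystem.norm_ratio_le hR hβn _ _).trans (pow_le_pow_right₀ one_le_two ?_)
          calc #(S.snbAll B Q₁) ≤ #(S.seedsOf B) + #(S.nbAll Q₁) := Finset.card_union_le _ _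
            _ ≤ K + D * #Q₁ := Nat.add_le_add_left (PlaqSystem.card_nbAll_le hR Q₁) _
        have h1 : ‖S.aPol F Q₁ β‖ ≤ r ^ (R * T) * ε₁ ^ #Q₁ := by
          by_cases hc : R * T ≤ #Q₁
          · calc ‖S.aPol F Q₁ β‖ ≤ 1 * ε ^ #Q₁ := PlaqSystem.norm_aPol_le hR hFb hβM Q₁
              _ = r ^ #Q₁ * ε₁ ^ #Q₁ := by rw [one_mul, hεr, mul_pow]
              _ ≤ r ^ (R * T) * ε₁ ^ #Q₁ :=
                  mul_le_mul_of_nonneg_right (pow_le_pow_of_le_one hr0 hr1 hc) (by positivity)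
          · have h0 : S.aPol F Q₁ β = 0 :=
              aPol_zdWilsonLoop_eq_zero ρ hρ hN hij hRL β (hV Q₁ hQ₁) (by omega)
            rw [h0, norm_zero]
            positivity
        calc ‖S.aPol F Q₁ β‖ * ‖S.ratio (torusGenuine d L) (S.snbAll B Q₁) β‖
            ≤ r ^ (R * T) * ε₁ ^ #Q₁ * 2 ^ (K + D * #Q₁) :=
              mul_le_mul h1 h2 (norm_nonneg _) (by positivity)
          _ = 2 ^ K * r ^ (R * T) * (ε₁ * 2 ^ D) ^ #Q₁ := by rw [pow_add, pow_mul, mul_pow]; ring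
    _ = 2 ^ K * r ^ (R * T) * ∑ Q₁ ∈ Tset, (ε₁ * 2 ^ D) ^ #Q₁ := by rw [Finset.mul_sum]
    _ ≤ 2 ^ K * r ^ (R * T) *
          Real.exp (#((torusGenuine d L).filter (S.Touches B)) * (1 / 2 : ℝ)) := by
        gcongr
        refine Polymer.sum_isSeedConn_pow_card_le (adj := S.Adj) (s := S.Touches B)
          (by positivity) (torusGenuine d L) fun t _ => ?_
        have := PlaqSystem.sum_isConn_eps_le hR hb1n (torusGenuine d L) t
        simpa only [hε₁] using this
    _ ≤ 2 ^ K * r ^ (R * T) * Real.exp (K * (1 / 2 : ℝ)) := by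
        gcongr
        exact_mod_cast Finset.card_le_card (S.filter_touches_subset B _)
    _ = (2 * Real.exp (1 / 2)) ^ K * r ^ (R * T) := by
        rw [mul_pow, ← Real.exp_nat_mul, mul_right_comm]
    _ ≤ (2 * Real.exp (1 / 2)) ^ (2 * (R + T) * (2 ^ d * (d * d))) * r ^ (R * T) := by
        gcongr

/-- **Volume-uniform area law for the torus Wilson states at strong coupling**
(Osterwalder–Seiler, Ann. Phys. 110 (1978) 440, Thm. 5.1 with Thm. 3.1 and Lemma 5.2, periodic
boundary conditions): for `G = SU(N)`, `N ≥ 2`, `i ≠ j`, `0 ≤ β ≤ β₁ = betaOne d ρ` and every torus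
`(ℤ/(L+1)ℤ)^d` with `L ≥ 2R + T + 2`,
`|⟨W_{R×T}⟩_{Λ_{L+1},β}| ≤ (2 e^{1/2})^{2(R+T) 2^d d²} (β/β₁)^{R T}`. [folklore] -/
theorem abs_wilsonExpectation_wilsonLoop_le (hρ : IsSpecialUnitaryModel ρ) (hN : 2 ≤ N)
    {i j : Fin d} (hij : i ≠ j) (R T : ℕ) {L : ℕ} (hL : 2 * R + T + 2 ≤ L) {β : ℝ} (hβ0 : 0 ≤ β)
    (hβ : β ≤ betaOne d ρ) :
    |wilsonExpectation (L := L + 1) ρ β (wilsonLoop ρ (0 : Site d (L + 1)) i j R T)| ≤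
      (2 * Real.exp (1 / 2)) ^ (2 * (R + T) * (2 ^ d * (d * d))) * (β / betaOne d ρ) ^ (R * T) := by
  haveI := IsSpecialUnitaryModel.secondCountableTopology ρ hρ
  haveI : Fact (1 < L + 1) := ⟨by omega⟩
  have hu := IsSpecialUnitaryModel.mem_unitaryGroup ρ hρ
  have h0 : Literature.Probability.LatticeModels.Torus.proj (L + 1)
      (0 : Literature.Probability.LatticeModels.Site d) = (0 : Site d (L + 1)) := by
    funext k; simp [Literature.Probability.LatticeModels.Torus.proj]
  have hW : wilsonLoop ρ (0 : Site d (L + 1)) i j R T = toTorusObservable (L + 1)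
      (zdWilsonLoop ρ (0 : Literature.Probability.LatticeModels.Site d) i j R T) := by
    funext U
    rw [toTorusObservable_apply, zdWilsonLoop_torusLift, h0]
  have hFm : Measurable (zdWilsonLoop ρ (0 : Literature.Probability.LatticeModels.Site d) i j R T) :=
    (continuous_zdWilsonLoop ρ hρ.1 0 i j R T).measurable
  have hFb : ∀ U, |zdWilsonLoop ρ (0 : Literature.Probability.LatticeModels.Site d) i j R T U| ≤ 1 :=
    abs_zdWilsonLoop_le ρ hu 0 i j R T
  rw [hW, wilsonExpectation_toTorusObservable_eq_re_expect ρ hρ.1 β hFm hFb]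
  have hobs : (fun U : ZdGaugeConfig d G =>
      ((zdWilsonLoop ρ 0 i j R T (U ∘ torusRed (L + 1)) : ℝ) : ℂ)) =
        fun U => ((zdWilsonLoop ρ 0 i j R T U : ℝ) : ℂ) := by
    funext U; rw [zdWilsonLoop_comp_torusRed ρ (by omega) U]
  rw [hobs]
  exact (Complex.abs_re_le_norm _).trans
    (norm_expect_zdWilsonLoop_le ρ hρ hN hij (by omega) (by omega) hβ0 hβ)

/-- `(0 : Fin d) ≠ 1` for `d ≥ 2`. [folklore] -/
theorem fin_zero_ne_one [NeZero d] (hd : 2 ≤ d) : (0 : Fin d) ≠ (1 : Fin d) := by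
  intro h01
  have := congrArg Fin.val h01
  rw [Fin.val_zero, Fin.val_one', Nat.one_mod_eq_one.mpr (by omega)] at this
  exact zero_ne_one this

/-- **The strong-coupling area law passes to infinite-volume limit points** (Osterwalder–Seiler
1978 Thm. 5.1; Seiler LNP 159 §2, Ch. 3): for `G = SU(N)`, `N ≥ 2`, `d ≥ 2` and `0 < β ≤ β₁`, every
`μ ∈ infiniteVolumeLimitPoints ρ β` satisfies the area law
`|W_μ(R,T)| ≤ K^{2(R+T)} e^{-c R T}` with `K = (2e^{1/2})^{2^d d²}` and rate
`c = -log (β/β₁)` (`> 0` for `β < β₁`). [folklore] -/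
theorem hasAreaLawWith_of_mem_infiniteVolumeLimitPoints [NeZero d] (hρ : IsSpecialUnitaryModel ρ)
    (hN : 2 ≤ N) (hd : 2 ≤ d) {β : ℝ} (hβ0 : 0 < β) (hβ : β ≤ betaOne d ρ)
    {μ : Measure (LGConfig d G)} (hμ : μ ∈ infiniteVolumeLimitPoints ρ β) :
    HasAreaLawWith μ (fun g => normalisedCharacter N (ρ g))
      ((2 * Real.exp (1 / 2)) ^ (2 ^ d * (d * d))) (-Real.log (β / betaOne d ρ)) := by
  intro R T _ _
  have hb1 : 0 < betaOne d ρ := betaOne_pos d (ρ := ρ)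
  have hr : 0 < β / betaOne d ρ := div_pos hβ0 hb1
  have hev : ∀ᶠ L : ℕ in atTop, |wilsonExpectation (L := L + 1) ρ β
      (wilsonLoop ρ (0 : Site d (L + 1)) 0 1 R T)| ≤
        (2 * Real.exp (1 / 2)) ^ (2 * (R + T) * (2 ^ d * (d * d))) * (β / betaOne d ρ) ^ (R * T) := by
    filter_upwards [eventually_ge_atTop (2 * R + T + 2)] with L hL
    exact abs_wilsonExpectation_wilsonLoop_le ρ hρ hN (fin_zero_ne_one hd) R T hL hβ0.le hβ
  have hexp : Real.exp (-(-Real.log (β / betaOne d ρ)) * R * T) = (β / betaOne d ρ) ^ (R * T) := by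
    rw [neg_neg, show Real.log (β / betaOne d ρ) * R * T =
      ((R * T : ℕ) : ℝ) * Real.log (β / betaOne d ρ) by push_cast; ring,
      Real.exp_nat_mul, Real.exp_log hr]
  rw [hexp, ← pow_mul, mul_comm (2 ^ d * (d * d)) (2 * (R + T))]
  exact abs_rectExpectation_le_of_eventually ρ hρ.1 hμ hev

/-- **Area law for limit states at strong coupling** (state form `HasAreaLawState`):
for `G = SU(N)`, `N ≥ 2`, `d ≥ 2` and `0 < β < β₁ = betaOne d ρ`, every infinite-volume limit point
satisfies an area law with rate `-log (β/β₁) > 0`. [folklore] -/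
theorem hasAreaLawState_of_mem_infiniteVolumeLimitPoints [NeZero d]
    (hρ : IsSpecialUnitaryModel ρ) (hN : 2 ≤ N) (hd : 2 ≤ d) {β : ℝ} (hβ0 : 0 < β)
    (hβ : β < betaOne d ρ) {μ : Measure (LGConfig d G)}
    (hμ : μ ∈ infiniteVolumeLimitPoints ρ β) :
    HasAreaLawState μ (fun g => normalisedCharacter N (ρ g)) := by
  refine ⟨_, _, ?_, hasAreaLawWith_of_mem_infiniteVolumeLimitPoints ρ hρ hN hd hβ0 hβ.le hμ⟩
  have hb1 : 0 < betaOne d ρ := betaOne_pos d (ρ := ρ)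
  rw [neg_pos]
  exact Real.log_neg (div_pos hβ0 hb1) ((div_lt_one hb1).2 hβ)

end Bound

/-! ### The concrete model `SU(N)` -/

/-- The defining representation of `Matrix.specialUnitaryGroup (Fin N) ℂ` is a special unitary
model in the sense of `Sweep1.IsSpecialUnitaryModel`. [folklore] -/
theorem isSpecialUnitaryModel_fundamentalRep (N : ℕ) :
    IsSpecialUnitaryModel (fundamentalRep (Fin N)) := by
  refine ⟨continuous_fundamentalRep (Fin N), fundamentalRep_injective (Fin N), ?_⟩
  ext M
  constructor
  · rintro ⟨U, rfl⟩
    exact U.2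
  · intro hM
    exact ⟨⟨M, hM⟩, rfl⟩

end TorusAreaLaw

end Literature.MathematicalPhysics.QuantumFieldTheory
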